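import Summits.BirchSwinnertonDyer.Rank1Residual.Additive.KatoDescentKatoRigidRepCalculus
import Summits.BirchSwinnertonDyer.Rank1Residual.Additive.KatoDescentKatoRigidAugValues
import HarnessLib

set_option autoImplicit false

/-!
# AUG engine, step 15: the EXPLICIT DICTIONARY — Kato's numbers `q·P(χ,1)·𝒸⁻_χ̄(c,d,a,A,d′)` of (★χ) are the values
# `R(u − 1)` of representatives of ONE level-independent Iwasawa function `Φ ∈ ℤ_p⟦T⟧` (after a `p`-power clearing),
# whose constant term is `p^v · q · R⁻_𝟙 · ∏_{ℓ ∣ A, ℓ ≠ p} P_ℓ(ℓ⁻¹)`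
# (seat `bsd-cm-prr-ty1` g15, cell `bsd-cm`; theorems only: no definition, no named fact, no instance, no `sorry`)

Part 57 of the seat's kernel cut of stub 3 of the Kato–Perrin-Riou skeletons v4 (cruxes stmt-BirchSwinnertonDyer-19945 /
-19223).  ENDGAME steps (R1)+(R2) of HOME `bsd-cm-prr-ty1/STUB3-CUT.md` §6 addendum 8.  The right-hand numbers of E35
`aeval_mul_explicitValues_eq_of_augData` at a character `χ` of `Gal(ℚ_n/ℚ)` mod `M = p^{n+1}` are
`X(χ) = q · ∏_{ℓ ∣ A, ℓ ≠ p} (1 − χ(ℓ)a_ℓ/ℓ + 𝟙_{ℓ∤N} χ(ℓ)²/ℓ) · (c²d²[a/A]⁻ − cd²χ̄(c)[ac/A]⁻ − c²dχ̄(d)[ad′/A]⁻ + cdχ̄(cd)[acd′/A]⁻)`.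
With E43's calculus (`read_*`) and its atoms (`χ̄(m) ↔ (1 + T)^{κ(σ_m)}`, `χ(ℓ) ↔ (1 + T)^{κ(σ_ℓ⁻¹)}`, `σ_m` with `χ_cyc(σ_m) = m`
at EVERY level), THIS FILE proves ★ `exists_iwasawaFunction_reads_explicitValues`: there are `v ∈ ℕ` and ONE `Φ ∈ ℤ_p⟦T⟧`,
independent of the level, with
* `Φ(0) = p^v · q · ratCuspFactor f true c d a A d′ · ∏_{ℓ ∈ (pA).primeFactors ∖ {p}} eulerFactorAtOne W N ℓ` (in `ℚ_p`), and
* for every level `n`, every character `χ` mod `M = p^{n+1}` killing `χ_cyc(Gal(ℚ̄/ℚ_n))` and every representative `R ≡ Φ (mod ω_n)`: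
  `p^v • (1 ⊗ X(χ)) = R(u − 1)` in `ℚ_p ⊗_ℚ ℂ`, `u = 1 ⊗ χ̄(χ_cyc γ)` —
the explicit Iwasawa function being `p^{v₀}q · ∏_ℓ (1 − (a_ℓ/ℓ)(1+T)^{κ(σ_ℓ⁻¹)} + (𝟙ℓ/ℓ²)(1+T)^{2κ(σ_ℓ⁻¹)}) ·
(c²d²p^{v₁}[a/A]⁻ − cd²p^{v₁}[ac/A]⁻(1+T)^{κ(σ_c)} − c²dp^{v₁}[ad′/A]⁻(1+T)^{κ(σ_d)} + cdp^{v₁}[acd′/A]⁻(1+T)^{κ(σ_{cd})})`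
(`a_ℓ = a_ℓ(W) ∈ ℤ` by `IsNewformOf`, `1/ℓ ∈ ℤ_p`, `p^{v₀}q, p^{v₁}[·]⁻ ∈ ℤ_p` by `p`-power clearing).  Auxiliary:
`primeFactors_filter_not_dvd_eq_erase` (the depletion set of E35 is `(pA).primeFactors ∖ {p}` at every level),
`coe_ringInverse_natCast` (`1/ℓ` in `ℤ_p`).
HONEST LABEL: bookkeeping of Kato's explicit constants; no stub closed; nothing asserted on 19945 / 19223; no summit statement
is proved; BSD is not proved for any curve.
References: [Kato2004Asterisque] Thm. 6.6 (1) (p. 163), Ex. 13.3 (p. 225), §13.9–Lemma 13.10 (pp. 229–230); [Washington1997]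
§7.1–§7.2, §13.1.
-/

noncomputable section

open scoped BigOperators TensorProduct
open Polynomial Field CongruenceSubgroup
open Literature.NumberTheory.GaloisRepresentations
open Literature.NumberTheory.EllipticCurves Literature.NumberTheory.EllipticCurves.ModularForms
open Literature.NumberTheory.EllipticCurves.Kato2004 Literature.NumberTheory.EllipticCurves.Kato2004.EulerSystemValues

namespace Summit.BirchSwinnertonDyer.Rank1Residual.Additive.PerrinRiouUnit

variable {p : ℕ} [hp : Fact p.Prime]

/-! ## §1 Auxiliary: the depletion set, `1/ℓ` in `ℤ_p`, monotone clearing -/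

/-- **The depletion set of (★χ) is level-independent**: for `M = p^{n+1}`,
`{ℓ ∣ M·p·A prime, ℓ ∤ M} = (p·A).primeFactors ∖ {p}`. [cite: Kato2004Asterisque, Ex. 13.3 (p. 225)] -/
theorem primeFactors_filter_not_dvd_eq_erase {n M : ℕ} (hM : M = p ^ (n + 1)) (A : ℕ) :
    (M * (p * A)).primeFactors.filter (fun ℓ => ¬ ℓ ∣ M) = (p * A).primeFactors.erase p := by
  classical
  have hM0 : M ≠ 0 := by rw [hM]; exact pow_ne_zero _ hp.out.ne_zero
  ext ℓ
  simp only [Finset.mem_filter, Nat.mem_primeFactors, Finset.mem_erase, ne_eq, mul_ne_zero_iff]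
  constructor
  · rintro ⟨⟨hℓ, hdvd, -, hpA⟩, hnd⟩
    have hℓp : ¬ ℓ = p := fun h => hnd (by rw [h, hM]; exact dvd_pow_self p (Nat.succ_ne_zero n))
    refine ⟨hℓp, hℓ, ?_, hpA⟩
    rcases (Nat.Prime.dvd_mul hℓ).mp hdvd with h | h
    · exact absurd (by rw [hM] at h; exact (Nat.prime_dvd_prime_iff_eq hℓ hp.out).mp (hℓ.dvd_of_dvd_pow h)) hℓp
    · exact h
  · rintro ⟨hℓp, hℓ, hdvd, hpA⟩
    refine ⟨⟨hℓ, dvd_mul_of_dvd_right hdvd M, hM0, hpA⟩, fun h => hℓp ?_⟩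
    rw [hM] at h
    exact (Nat.prime_dvd_prime_iff_eq hℓ hp.out).mp (hℓ.dvd_of_dvd_pow h)

/-- A prime `ℓ ≠ p` is a unit of `ℤ_p`. [folklore] -/
theorem isUnit_natCast_padicInt {ℓ : ℕ} (hℓ : ℓ.Prime) (hℓp : ℓ ≠ p) : IsUnit ((ℓ : ℤ_[p])) := by
  rw [PadicInt.isUnit_iff]
  refine le_antisymm (PadicInt.norm_le_one _) (not_lt.mp fun hlt => hℓp ?_)
  rw [← Int.cast_natCast, PadicInt.norm_int_lt_one_iff_dvd, Int.natCast_dvd_natCast] at hlt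
  exact ((Nat.prime_dvd_prime_iff_eq hp.out hℓ).mp hlt).symm

/-- **`1/ℓ` in `ℤ_p`**: the coercion to `ℚ_p` of `Ring.inverse (ℓ : ℤ_p)` is the rational `ℓ⁻¹` (`ℓ ≠ p` prime). [folklore] -/
theorem coe_ringInverse_natCast {ℓ : ℕ} (hℓ : ℓ.Prime) (hℓp : ℓ ≠ p) :
    ((Ring.inverse (ℓ : ℤ_[p]) : ℤ_[p]) : ℚ_[p]) = (((ℓ : ℚ)⁻¹ : ℚ) : ℚ_[p]) := by
  have h1 : ((ℓ : ℤ_[p]) : ℚ_[p]) * ((Ring.inverse (ℓ : ℤ_[p]) : ℤ_[p]) : ℚ_[p]) = 1 := by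
    rw [← PadicInt.coe_mul, Ring.mul_inverse_cancel _ (isUnit_natCast_padicInt hℓ hℓp), PadicInt.coe_one]
  rw [eq_inv_of_mul_eq_one_right h1]
  push_cast
  rfl

/-- Monotone `p`-power clearing: if `p^v r ∈ ℤ_p` then `p^{v+w} r ∈ ℤ_p`. [folklore] -/
theorem norm_pow_add_mul_ratCast_le_one {r : ℚ} {v : ℕ} (h : ‖(((p : ℚ) ^ v * r : ℚ) : ℚ_[p])‖ ≤ 1) (w : ℕ) :
    ‖(((p : ℚ) ^ (v + w) * r : ℚ) : ℚ_[p])‖ ≤ 1 := by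
  have e : (((p : ℚ) ^ (v + w) * r : ℚ) : ℚ_[p]) = ((p : ℚ_[p]) ^ w) * (((p : ℚ) ^ v * r : ℚ) : ℚ_[p]) := by
    push_cast; ring
  rw [e, norm_mul, norm_pow]
  exact mul_le_one₀ (pow_le_one₀ (norm_nonneg _) Padic.norm_p_lt_one.le) (norm_nonneg _) h

/-- An integer multiple of a rational in `ℤ_p` is in `ℤ_p`. [folklore] -/
theorem norm_intCast_mul_ratCast_le_one (m : ℤ) {r : ℚ} (h : ‖(r : ℚ_[p])‖ ≤ 1) : ‖(((m : ℚ) * r : ℚ) : ℚ_[p])‖ ≤ 1 := by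
  push_cast
  rw [norm_mul]
  exact mul_le_one₀ (Padic.norm_int_le_one m) (norm_nonneg _) h

/-- `r • (1 ⊗ x) = 1 ⊗ (r·x)` in `ℚ_p ⊗_ℚ ℂ` for a rational `r` (cast into `ℚ_p` on the left, into `ℂ` on the right). [folklore] -/
theorem ratCast_smul_one_tmul (r : ℚ) (x : ℂ) :
    (r : ℚ_[p]) • ((1 : ℚ_[p]) ⊗ₜ[ℚ] x : ℚ_[p] ⊗[ℚ] ℂ) = (1 : ℚ_[p]) ⊗ₜ[ℚ] ((r : ℂ) * x) := by
  rw [← Rat.smul_def, TensorProduct.tmul_smul, ← eq_ratCast (algebraMap ℚ ℚ_[p]) r, algebraMap_smul]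

/-! ## §2 The explicit Iwasawa function reading Kato's numbers -/

section Main

variable {K : ZpExtension ℚ p} {γ : absoluteGaloisGroup ℚ}

set_option maxHeartbeats 1600000 in
/-- ★ **The explicit dictionary.**  For the newform `f` of `W`, a rational `q`, Kato parameters `(c, d, a, A, d′)` with `p ∤ c`,
`p ∤ d`, a cyclotomic `ℤ_p`-extension `K` with topological generator `γ`: there are `v ∈ ℕ` and ONE `Φ ∈ ℤ_p⟦T⟧` with
constant term `p^v · q · ratCuspFactor f true c d a A d′ · ∏_{ℓ ∈ (pA).primeFactors ∖ {p}} eulerFactorAtOne W N ℓ` such that for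
every level `n`, every Dirichlet character `χ` mod `M = p^{n+1}` killing `χ_cyc(Gal(ℚ̄/ℚ_n))` and every representative
`R ≡ Φ (mod ω_n)`: `p^v • (1 ⊗ q·P(χ,1)·𝒸⁻_χ̄(c,d,a,A,d′)) = R(u − 1)` in `ℚ_p ⊗_ℚ ℂ`, `u = 1 ⊗ χ̄(χ_cyc γ)` — the numbers of (★χ)
(E35) in exactly E35's spelling. [cite: Kato2004Asterisque, Thm. 6.6 (1) (p. 163), Ex. 13.3 (p. 225), §13.9 (p. 230)]
[cite: Washington1997, §7.1–§7.2 and §13.1] -/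
theorem exists_iwasawaFunction_reads_explicitValues (hγ : K.IsTopGenerator γ) (W : WeierstrassCurve ℚ) {N : ℕ} [NeZero N]
    {f : CuspForm (Gamma0 N) 2} (hnf : IsNewformOf W f) (q : ℚ) {c d : ℤ} (a : ℤ) (A : ℕ) (d' : ℤ)
    (hc : IsCoprime c p) (hd : IsCoprime d p) :
    ∃ (v : ℕ) (Φ : PowerSeries ℤ_[p]),
      ((PowerSeries.constantCoeff Φ : ℤ_[p]) : ℚ_[p]) =
        (((p : ℚ) ^ v * (q * ratCuspFactor f true c d a A d' *
            ∏ ℓ ∈ (p * A).primeFactors.erase p, eulerFactorAtOne W N ℓ) : ℚ) : ℚ_[p]) ∧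
      ∀ (n : ℕ) {M : ℕ} [NeZero M] (_hM : M = p ^ (n + 1)) (χ : DirichletCharacter ℂ M)
        (_hχ : ∀ τ ∈ K.layerSubgroup n, χ ((modNCyclotomicCharacter ℚ M τ : (ZMod M)ˣ) : ZMod M) = 1)
        (R : ℤ_[p][X]),
        Φ - (R : PowerSeries ℤ_[p]) ∈
          Ideal.span {(((X + 1 : ℤ_[p][X]) ^ p ^ n - 1 : ℤ_[p][X]) : PowerSeries ℤ_[p])} →
        ((p : ℚ_[p]) ^ v) • ((1 : ℚ_[p]) ⊗ₜ[ℚ] ((((q : ℚ) : ℝ) : ℂ) *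
          (∏ ℓ ∈ (M * (p * A)).primeFactors.filter (fun ℓ => ¬ ℓ ∣ M),
              (1 - χ (ℓ : ZMod M) * cuspCoeff f ℓ * (ℓ : ℂ) ^ (-(1 : ℂ)) +
                (if ℓ ∣ N then 0 else (ℓ : ℂ)) * χ (ℓ : ZMod M) ^ 2 * ((ℓ : ℂ) ^ (-(1 : ℂ))) ^ 2)) *
          cuspFactor f true (fun k ↦ χ⁻¹ (k : ZMod M)) c d a A d') : ℚ_[p] ⊗[ℚ] ℂ) =
        aeval (((1 : ℚ_[p]) ⊗ₜ[ℚ] χ⁻¹ ((modNCyclotomicCharacter ℚ M γ : (ZMod M)ˣ) : ZMod M) : ℚ_[p] ⊗[ℚ] ℂ) - 1) R := by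
  classical
  -- Galois elements with prescribed cyclotomic characters at every level
  obtain ⟨σc, hσc⟩ := exists_forall_modNCyclotomicCharacter_eq_intCast (p := p) hc
  obtain ⟨σd, hσd⟩ := exists_forall_modNCyclotomicCharacter_eq_intCast (p := p) hd
  obtain ⟨σcd, hσcd⟩ := exists_forall_modNCyclotomicCharacter_eq_intCast (p := p) (hc.mul_left hd)
  have hτ : ∀ ℓ : ℕ, ∃ σ : absoluteGaloisGroup ℚ, ℓ.Prime → ℓ ≠ p → ∀ (j : ℕ) [NeZero (p ^ j)],
      ((modNCyclotomicCharacter ℚ (p ^ j) σ : (ZMod (p ^ j))ˣ) : ZMod (p ^ j)) = (ℓ : ZMod (p ^ j)) := by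
    intro ℓ
    by_cases h : ℓ.Prime ∧ ℓ ≠ p
    · have hcop : IsCoprime (ℓ : ℤ) p := by
        rw [Int.isCoprime_iff_gcd_eq_one, Int.gcd_natCast_natCast]
        exact (Nat.coprime_primes h.1 hp.out).mpr h.2
      obtain ⟨σ, hσ⟩ := exists_forall_modNCyclotomicCharacter_eq_intCast (p := p) hcop
      exact ⟨σ, fun _ _ j _ => by rw [hσ j, Int.cast_natCast]⟩
    · exact ⟨1, fun h1 h2 => absurd ⟨h1, h2⟩ h⟩
  choose τ hτ using hτ
  -- abbreviations for the rational constants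
  set S' : Finset ℕ := (p * A).primeFactors.erase p with hS'
  set s₁ : ℚ := ratMinusSymbol f ((a : ℚ) / A) with hs₁
  set s₂ : ℚ := ratMinusSymbol f ((a * c : ℚ) / A) with hs₂
  set s₃ : ℚ := ratMinusSymbol f ((a * d' : ℚ) / A) with hs₃
  set s₄ : ℚ := ratMinusSymbol f ((a * c * d' : ℚ) / A) with hs₄
  -- `p`-power clearing
  obtain ⟨v₀, hv₀⟩ := exists_norm_pow_mul_ratCast_le_one (p := p) q
  obtain ⟨w₁, hw₁⟩ := exists_norm_pow_mul_ratCast_le_one (p := p) s₁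
  obtain ⟨w₂, hw₂⟩ := exists_norm_pow_mul_ratCast_le_one (p := p) s₂
  obtain ⟨w₃, hw₃⟩ := exists_norm_pow_mul_ratCast_le_one (p := p) s₃
  obtain ⟨w₄, hw₄⟩ := exists_norm_pow_mul_ratCast_le_one (p := p) s₄
  set v₁ : ℕ := w₁ + w₂ + w₃ + w₄ with hv₁
  have hu₁ : ‖(((p : ℚ) ^ v₁ * s₁ : ℚ) : ℚ_[p])‖ ≤ 1 := by
    rw [hv₁, show w₁ + w₂ + w₃ + w₄ = w₁ + (w₂ + w₃ + w₄) by ring]; exact norm_pow_add_mul_ratCast_le_one hw₁ _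
  have hu₂ : ‖(((p : ℚ) ^ v₁ * s₂ : ℚ) : ℚ_[p])‖ ≤ 1 := by
    rw [hv₁, show w₁ + w₂ + w₃ + w₄ = w₂ + (w₁ + w₃ + w₄) by ring]; exact norm_pow_add_mul_ratCast_le_one hw₂ _
  have hu₃ : ‖(((p : ℚ) ^ v₁ * s₃ : ℚ) : ℚ_[p])‖ ≤ 1 := by
    rw [hv₁, show w₁ + w₂ + w₃ + w₄ = w₃ + (w₁ + w₂ + w₄) by ring]; exact norm_pow_add_mul_ratCast_le_one hw₃ _
  have hu₄ : ‖(((p : ℚ) ^ v₁ * s₄ : ℚ) : ℚ_[p])‖ ≤ 1 := by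
    rw [hv₁, show w₁ + w₂ + w₃ + w₄ = w₄ + (w₁ + w₂ + w₃) by ring]; exact norm_pow_add_mul_ratCast_le_one hw₄ _
  -- the integral constants
  have hk₁ := norm_intCast_mul_ratCast_le_one (p := p) (c ^ 2 * d ^ 2) hu₁
  have hk₂ := norm_intCast_mul_ratCast_le_one (p := p) (c * d ^ 2) hu₂
  have hk₃ := norm_intCast_mul_ratCast_le_one (p := p) (c ^ 2 * d) hu₃
  have hk₄ := norm_intCast_mul_ratCast_le_one (p := p) (c * d) hu₄
  set yq : ℤ_[p] := ⟨_, hv₀⟩ with hyq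
  set yk₁ : ℤ_[p] := ⟨_, hk₁⟩ with hyk₁
  set yk₂ : ℤ_[p] := ⟨_, hk₂⟩ with hyk₂
  set yk₃ : ℤ_[p] := ⟨_, hk₃⟩ with hyk₃
  set yk₄ : ℤ_[p] := ⟨_, hk₄⟩ with hyk₄
  have hS'mem : ∀ ℓ ∈ S', ℓ.Prime ∧ ℓ ≠ p := fun ℓ hℓ => by
    rw [hS', Finset.mem_erase, Nat.mem_primeFactors] at hℓ
    exact ⟨hℓ.2.1, hℓ.1⟩
  -- the Iwasawa function
  refine ⟨v₀ + v₁,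
    PowerSeries.C yq *
      (∏ ℓ ∈ S', (1 - PowerSeries.binomialSeries ℤ_[p] (K (τ ℓ)⁻¹).toAdd *
            PowerSeries.C (((W.LFunction ℓ : ℤ) : ℤ_[p]) * Ring.inverse (ℓ : ℤ_[p])) +
          PowerSeries.binomialSeries ℤ_[p] (K (τ ℓ)⁻¹).toAdd * PowerSeries.binomialSeries ℤ_[p] (K (τ ℓ)⁻¹).toAdd *
            PowerSeries.C ((((if ℓ ∣ N then (0 : ℤ) else (ℓ : ℤ)) : ℤ) : ℤ_[p]) *
              Ring.inverse (ℓ : ℤ_[p]) * Ring.inverse (ℓ : ℤ_[p])))) *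
      (PowerSeries.C yk₁ - PowerSeries.binomialSeries ℤ_[p] (K σc).toAdd * PowerSeries.C yk₂ -
        PowerSeries.binomialSeries ℤ_[p] (K σd).toAdd * PowerSeries.C yk₃ +
        PowerSeries.binomialSeries ℤ_[p] (K σcd).toAdd * PowerSeries.C yk₄), ?_, ?_⟩
  · -- the constant term
    have hE : ∀ ℓ ∈ S', ((PowerSeries.constantCoeff
        (1 - PowerSeries.binomialSeries ℤ_[p] (K (τ ℓ)⁻¹).toAdd *
            PowerSeries.C (((W.LFunction ℓ : ℤ) : ℤ_[p]) * Ring.inverse (ℓ : ℤ_[p])) +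
          PowerSeries.binomialSeries ℤ_[p] (K (τ ℓ)⁻¹).toAdd * PowerSeries.binomialSeries ℤ_[p] (K (τ ℓ)⁻¹).toAdd *
            PowerSeries.C ((((if ℓ ∣ N then (0 : ℤ) else (ℓ : ℤ)) : ℤ) : ℤ_[p]) *
              Ring.inverse (ℓ : ℤ_[p]) * Ring.inverse (ℓ : ℤ_[p]))) : ℤ_[p]) : ℚ_[p]) =
        ((eulerFactorAtOne W N ℓ : ℚ) : ℚ_[p]) := fun ℓ hℓ => by
      obtain ⟨hℓ, hℓp⟩ := hS'mem ℓ hℓ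
      have hℓ0 : (ℓ : ℚ_[p]) ≠ 0 := by exact_mod_cast hℓ.ne_zero
      simp only [map_sub, map_add, map_mul, map_one, PowerSeries.constantCoeff_C, PowerSeries.binomialSeries_constantCoeff,
        one_mul]
      unfold eulerFactorAtOne
      by_cases h : ℓ ∣ N
      · simp only [if_pos h]
        push_cast [coe_ringInverse_natCast hℓ hℓp, div_eq_mul_inv]
        ring
      · simp only [if_neg h]
        push_cast [coe_ringInverse_natCast hℓ hℓp, div_eq_mul_inv]
        field_simp
    have hR : ((PowerSeries.constantCoeff
        (PowerSeries.C yk₁ - PowerSeries.binomialSeries ℤ_[p] (K σc).toAdd * PowerSeries.C yk₂ -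
          PowerSeries.binomialSeries ℤ_[p] (K σd).toAdd * PowerSeries.C yk₃ +
          PowerSeries.binomialSeries ℤ_[p] (K σcd).toAdd * PowerSeries.C yk₄) : ℤ_[p]) : ℚ_[p]) =
        (((p : ℚ) ^ v₁ * ratCuspFactor f true c d a A d' : ℚ) : ℚ_[p]) := by
      simp only [map_sub, map_add, map_mul, PowerSeries.constantCoeff_C, PowerSeries.binomialSeries_constantCoeff, one_mul]
      rw [PadicInt.coe_add, PadicInt.coe_sub, PadicInt.coe_sub, hyk₁, hyk₂, hyk₃, hyk₄]
      change (((c ^ 2 * d ^ 2 : ℤ) : ℚ) * ((p : ℚ) ^ v₁ * s₁) : ℚ_[p]) - (((c * d ^ 2 : ℤ) : ℚ) * ((p : ℚ) ^ v₁ * s₂) : ℚ_[p]) -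
          (((c ^ 2 * d : ℤ) : ℚ) * ((p : ℚ) ^ v₁ * s₃) : ℚ_[p]) + (((c * d : ℤ) : ℚ) * ((p : ℚ) ^ v₁ * s₄) : ℚ_[p]) = _
      simp only [ratCuspFactor, ↓reduceIte, ← hs₁, ← hs₂, ← hs₃, ← hs₄]
      push_cast
      ring
    rw [map_mul, map_mul, PowerSeries.constantCoeff_C, map_prod, PadicInt.coe_mul, PadicInt.coe_mul, hR,
      show ∀ g : ℕ → ℤ_[p], (((∏ ℓ ∈ S', g ℓ : ℤ_[p])) : ℚ_[p]) = ∏ ℓ ∈ S', ((g ℓ : ℤ_[p]) : ℚ_[p]) from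
        fun g => map_prod PadicInt.Coe.ringHom g S',
      Finset.prod_congr rfl hE, hyq]
    change (((p : ℚ) ^ v₀ * q : ℚ) : ℚ_[p]) * _ * _ = _
    push_cast
    ring
  · -- the reading at a character of level `p^{n+1}`
    intro n M _ hM χ hχ R hRrep
    subst hM
    have hu := one_tmul_inv_apply_pow_eq_one (p := p) hγ n χ hχ
    have hread := read_mul hu
      (read_mul hu (read_const hu ((p : ℚ) ^ v₀ * q) yq rfl)
        (read_prod hu S' (fun ℓ hℓ =>
          read_add hu
            (read_sub hu (read_one hu)
              (read_mul hu (read_apply hγ n χ hχ (τ ℓ) (hτ ℓ (hS'mem ℓ hℓ).1 (hS'mem ℓ hℓ).2 (n + 1)))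
                (read_const hu (((W.LFunction ℓ : ℤ) : ℚ) * (ℓ : ℚ)⁻¹)
                  (((W.LFunction ℓ : ℤ) : ℤ_[p]) * Ring.inverse (ℓ : ℤ_[p]))
                  (by rw [PadicInt.coe_mul, coe_ringInverse_natCast (hS'mem ℓ hℓ).1 (hS'mem ℓ hℓ).2]; push_cast; ring))))
            (read_mul hu
              (read_mul hu (read_apply hγ n χ hχ (τ ℓ) (hτ ℓ (hS'mem ℓ hℓ).1 (hS'mem ℓ hℓ).2 (n + 1)))
                (read_apply hγ n χ hχ (τ ℓ) (hτ ℓ (hS'mem ℓ hℓ).1 (hS'mem ℓ hℓ).2 (n + 1))))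
              (read_const hu ((((if ℓ ∣ N then (0 : ℤ) else (ℓ : ℤ)) : ℤ) : ℚ) * (ℓ : ℚ)⁻¹ * (ℓ : ℚ)⁻¹)
                ((((if ℓ ∣ N then (0 : ℤ) else (ℓ : ℤ)) : ℤ) : ℤ_[p]) * Ring.inverse (ℓ : ℤ_[p]) * Ring.inverse (ℓ : ℤ_[p]))
                (by
                  rw [PadicInt.coe_mul, PadicInt.coe_mul, coe_ringInverse_natCast (hS'mem ℓ hℓ).1 (hS'mem ℓ hℓ).2]
                  by_cases h : ℓ ∣ N
                  · simp only [if_pos h]; push_cast; ring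
                  · simp only [if_neg h]; push_cast; ring))))))
      (read_add hu
        (read_sub hu
          (read_sub hu (read_const hu _ yk₁ rfl)
            (read_mul hu (read_inv_apply hγ n χ hχ σc (hσc (n + 1))) (read_const hu _ yk₂ rfl)))
          (read_mul hu (read_inv_apply hγ n χ hχ σd (hσd (n + 1))) (read_const hu _ yk₃ rfl)))
        (read_mul hu (read_inv_apply hγ n χ hχ σcd (hσcd (n + 1))) (read_const hu _ yk₄ rfl)))
    rw [← hread R hRrep, primeFactors_filter_not_dvd_eq_erase (p := p) (n := n) rfl A, ← hS',
      show (p : ℚ_[p]) ^ (v₀ + v₁) = (((p : ℚ) ^ (v₀ + v₁) : ℚ) : ℚ_[p]) by push_cast; rfl, ratCast_smul_one_tmul]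
    congr 1
    have hprodC : (∏ ℓ ∈ S', (1 - χ (ℓ : ZMod (p ^ (n + 1))) * cuspCoeff f ℓ * (ℓ : ℂ) ^ (-(1 : ℂ)) +
        (if ℓ ∣ N then 0 else (ℓ : ℂ)) * χ (ℓ : ZMod (p ^ (n + 1))) ^ 2 * ((ℓ : ℂ) ^ (-(1 : ℂ))) ^ 2)) =
        ∏ ℓ ∈ S', (1 - χ (ℓ : ZMod (p ^ (n + 1))) * ((((W.LFunction ℓ : ℤ) : ℚ) * (ℓ : ℚ)⁻¹ : ℚ) : ℂ) +
          χ (ℓ : ZMod (p ^ (n + 1))) * χ (ℓ : ZMod (p ^ (n + 1))) *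
            (((((if ℓ ∣ N then (0 : ℤ) else (ℓ : ℤ)) : ℤ) : ℚ) * (ℓ : ℚ)⁻¹ * (ℓ : ℚ)⁻¹ : ℚ) : ℂ)) := by
      refine Finset.prod_congr rfl fun ℓ _ => ?_
      rw [hnf.2 ℓ, Complex.cpow_neg_one]
      by_cases h : ℓ ∣ N
      · simp only [if_pos h]
        push_cast
        ring
      · simp only [if_neg h]
        push_cast
        ring
    rw [hprodC, Complex.ofReal_ratCast]
    simp only [cuspFactor, ↓reduceIte, ← hs₁, ← hs₂, ← hs₃, ← hs₄]
    push_cast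
    ring

end Main

end Summit.BirchSwinnertonDyer.Rank1Residual.Additive.PerrinRiouUnit

end
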